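import Summits.HubbardSuperconductivity.HubbardSuperconductivity.Theorems.AnisotropyChordTransferFibre3LatticeSums
import Summits.HubbardSuperconductivity.HubbardSuperconductivity.Theorems.AnisotropyChordTransferFibre3RingCountUpper

/-!
# Route `AnisotropyChord` / H0 rotor rung: lattice sums for `LamIncrementBound` — `Σ_{m ≠ 0} |mᵢ|·W(m) ≤ 28` over the punctured box

Pure `ℤ²` bookkeeping for theory-1 g22's PartN41-C §4 `LamIncrementBound` (port …Fibre3KT2bRow): the ring decomposition of the
punctured box `{0 < |m|∞ ≤ N}` (★ `sum_sdiff_pbox_le`: a ring-wise bound `g ≤ φ(n)` on the ring `|m|∞ = n + 1`, which has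
`8(n+1)` points, sums to `Σ 8(n+1)φ(n)`), the telescoping bound ★ `sum_inv_sq_Icc_le` (`Σ_{a<j≤b} 1/j² ≤ 1/a`), the exact
innermost ring, and the assembled estimate ★ `box_weight_sum_le`:
`Σ_{m ∈ box∖0} |mᵢ| / (c_m|m|²(2c_m|m|² − κ)) ≤ 28` with `κ = 0.0513`, `c_m = 0.47` on `|m|∞ ≤ N₁` and `c_m = 0.2` beyond,
for `16 ≤ N₁ ≤ N` (the weights are the Jordan-type lower bounds `ε(k) ≥ c θ²|m|²` of the two regions).
Prover seat `hubbard-h0-rotor-p1` g27 (route lead); helper for stmt-HubbardSuperconductivity-23918 (`--supports`, helper class).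
WHAT THIS IS NOT: nothing here proves superconductivity in the Hubbard model; arithmetic for one L-uniform constant of ONE row of
ONE conditional reduction.  Tree imports only; no new definitions; no sorry, no axioms.
-/

set_option linter.dupNamespace false
set_option autoImplicit false

noncomputable section

open scoped BigOperators

namespace Summit.HubbardSuperconductivity.HubbardSuperconductivity.Theorems.AnisotropyChord.Transfer.Fibre3

namespace RowC

open RateLemma Finset

/-! ## §1 Telescoping -/

/-- `Σ_{j ∈ (a, b]} 1/j² ≤ 1/a − 1/b` for `1 ≤ a ≤ b`. [folklore] -/
theorem sum_inv_sq_Icc_le' (a : ℕ) (ha : 1 ≤ a) :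
    ∀ b : ℕ, a ≤ b → ∑ j ∈ Finset.Icc (a + 1) b, (1 : ℝ) / (j : ℝ) ^ 2 ≤ 1 / (a : ℝ) - 1 / (b : ℝ) := by
  intro b hb
  induction b with
  | zero =>
    have : a = 0 := Nat.le_zero.mp hb
    omega
  | succ b ih =>
    by_cases hab : a ≤ b
    · rw [Finset.sum_Icc_succ_top (by omega)]
      have h1 := ih hab
      have hb0 : (0 : ℝ) < b := by exact_mod_cast (show 0 < b by omega)
      have key : (1 : ℝ) / ((b + 1 : ℕ) : ℝ) ^ 2 ≤ 1 / (b : ℝ) - 1 / ((b + 1 : ℕ) : ℝ) := by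
        push_cast
        rw [div_sub_div _ _ hb0.ne' (by positivity), div_le_div_iff₀ (by positivity) (by positivity)]
        nlinarith
      linarith
    · have hab' : a = b + 1 := by omega
      subst hab'
      simp

/-- `Σ_{j ∈ (a, b]} 1/j² ≤ 1/a` for `1 ≤ a`. [folklore] -/
theorem sum_inv_sq_Icc_le (a b : ℕ) (ha : 1 ≤ a) :
    ∑ j ∈ Finset.Icc (a + 1) b, (1 : ℝ) / (j : ℝ) ^ 2 ≤ 1 / (a : ℝ) := by
  by_cases hb : a ≤ b
  · have h := sum_inv_sq_Icc_le' a ha b hb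
    have : 0 ≤ 1 / (b : ℝ) := by positivity
    linarith
  · have : Finset.Icc (a + 1) b = ∅ := Finset.Icc_eq_empty (by omega)
    rw [this, Finset.sum_empty]
    positivity

/-! ## §2 Ring decomposition of the punctured box -/

/-- the ring `|m|∞ = n + 1` has `8(n+1)` points. [folklore] -/
theorem card_ring (n : ℕ) : ((puncturedBox (n + 1) \ puncturedBox n).card : ℝ) = 8 * ((n : ℝ) + 1) := by
  rw [Finset.card_sdiff_of_subset (puncturedBox_mono n), card_puncturedBox, card_puncturedBox,
    show 4 * (n + 1) * (n + 1 + 1) = 8 * (n + 1) + 4 * n * (n + 1) by ring, Nat.add_sub_cancel]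
  push_cast
  ring

/-- on the ring `|m|∞ = n + 1`: `|m₁|, |m₂| ≤ n + 1` and `|m|² ≥ (n+1)²`. [folklore] -/
theorem ring_facts (n : ℕ) (m : ℤ × ℤ) (hm : m ∈ puncturedBox (n + 1) \ puncturedBox n) :
    (m.1.natAbs : ℝ) ≤ (n : ℝ) + 1 ∧ (m.2.natAbs : ℝ) ≤ (n : ℝ) + 1 ∧
      ((n : ℝ) + 1) ^ 2 ≤ (((m.1 ^ 2 + m.2 ^ 2 : ℤ)) : ℝ) ∧ (m.1.natAbs = n + 1 ∨ m.2.natAbs = n + 1) := by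
  have hsq := ring_normSq_ge n m hm
  rw [Finset.mem_sdiff, mem_puncturedBox, mem_puncturedBox] at hm
  obtain ⟨⟨h0, ⟨h1, h2⟩, ⟨h3, h4⟩⟩, hn⟩ := hm
  push_cast at h1 h2 h3 h4
  have a1 : m.1.natAbs ≤ n + 1 := by omega
  have a2 : m.2.natAbs ≤ n + 1 := by omega
  refine ⟨by exact_mod_cast a1, by exact_mod_cast a2, hsq, ?_⟩
  by_contra hcon
  push Not at hcon
  apply hn
  refine ⟨h0, ⟨by omega, by omega⟩, ⟨by omega, by omega⟩⟩

/-- ★ RING DECOMPOSITION: a ring-wise bound `g ≤ φ(n)` on `|m|∞ = n+1` (`N₀ ≤ n < N`) gives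
`Σ_{pbox N ∖ pbox N₀} g ≤ Σ_{n ∈ [N₀,N)} 8(n+1)φ(n)`. [folklore] -/
theorem sum_sdiff_pbox_le (g : ℤ × ℤ → ℝ) (φ : ℕ → ℝ) (N₀ : ℕ) :
    ∀ N : ℕ, N₀ ≤ N → (∀ n : ℕ, N₀ ≤ n → n < N → ∀ m ∈ puncturedBox (n + 1) \ puncturedBox n, g m ≤ φ n) →
      ∑ m ∈ puncturedBox N \ puncturedBox N₀, g m ≤ ∑ n ∈ Finset.Ico N₀ N, 8 * ((n : ℝ) + 1) * φ n := by
  intro N hN hg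
  induction N with
  | zero =>
    have : N₀ = 0 := Nat.le_zero.mp hN
    subst this; simp
  | succ N ih =>
    by_cases hN0 : N₀ ≤ N
    · have ih' := ih hN0 (fun n h1 h2 m hm => hg n h1 (by omega) m hm)
      rw [Finset.sum_sdiff_eq_sub (puncturedBox_subset (by omega : N₀ ≤ N + 1)), Finset.sum_Ico_succ_top hN0]
      rw [Finset.sum_sdiff_eq_sub (puncturedBox_subset hN0)] at ih'
      -- the new ring
      have hring : ∑ m ∈ puncturedBox (N + 1) \ puncturedBox N, g m ≤ 8 * ((N : ℝ) + 1) * φ N := by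
        have h := Finset.sum_le_card_nsmul _ _ _ (fun m hm => hg N hN0 (by omega) m hm)
        rw [nsmul_eq_mul, card_ring] at h
        exact h
      rw [Finset.sum_sdiff_eq_sub (puncturedBox_mono N)] at hring
      linarith
    · have : N₀ = N + 1 := by omega
      subst this; simp

/-! ## §3 The innermost ring, exactly, and the generic ring weight bound -/

/-- the innermost ring. [folklore] -/
theorem pbox_one_eq : puncturedBox 1 = {(-1, -1), (-1, 0), (-1, 1), (0, -1), (0, 1), (1, -1), (1, 0), (1, 1)} := by
  decide

/-- monotonicity of the weight in the ring variables: `s ≤ t`, `t² ≤ q` ⇒ `s/(cq(2cq − κ)) ≤ 1/(ct(2ct² − κ))`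
(`s ≤ t` with `t > 0`; no sign condition on `s` is needed). [folklore] -/
theorem weight_le (c s q t : ℝ) (hc : 0 < c) (ht : 0 < t) (hs : s ≤ t) (hq : t ^ 2 ≤ q)
    (hden : 0 < 2 * c * t ^ 2 - 0.0513) :
    s / (c * q * (2 * c * q - 0.0513)) ≤ 1 / (c * t * (2 * c * t ^ 2 - 0.0513)) := by
  have hq0 : 0 < q := lt_of_lt_of_le (by positivity) hq
  have hden' : 0 < 2 * c * q - 0.0513 := by nlinarith
  have hD : 0 < c * q * (2 * c * q - 0.0513) := by positivity
  have hDt : 0 < c * t * (2 * c * t ^ 2 - 0.0513) := by positivity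
  rw [div_le_div_iff₀ hD hDt, one_mul]
  have h1 : t * (2 * c * t ^ 2 - 0.0513) ≤ q / t * (2 * c * q - 0.0513) := by
    have hqt : t ≤ q / t := by rw [le_div_iff₀ ht]; nlinarith
    exact mul_le_mul hqt (by nlinarith) hden.le (by positivity)
  calc s * (c * t * (2 * c * t ^ 2 - 0.0513)) = c * s * (t * (2 * c * t ^ 2 - 0.0513)) := by ring
    _ ≤ c * t * (q / t * (2 * c * q - 0.0513)) := by
        exact mul_le_mul (by nlinarith) h1 (by positivity) (by positivity)
    _ = c * q * (2 * c * q - 0.0513) := by field_simp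

/-- the per-ring numerics, inner region: `8/(0.47(0.94t² − κ)) ≤ 18.4/t²` for `t ≥ 2`. [folklore] -/
theorem ring_num_inner (t : ℝ) (ht : 2 ≤ t) :
    8 * t * (1 / (0.47 * t * (2 * 0.47 * t ^ 2 - 0.0513))) ≤ 18.4 * (1 / t ^ 2) := by
  have ht0 : 0 < t := by linarith
  have hden : 0 < 2 * 0.47 * t ^ 2 - 0.0513 := by nlinarith
  rw [show 8 * t * (1 / (0.47 * t * (2 * 0.47 * t ^ 2 - 0.0513))) = 8 / (0.47 * (2 * 0.47 * t ^ 2 - 0.0513)) by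
    field_simp]
  rw [div_le_iff₀ (by positivity), show (18.4 : ℝ) * (1 / t ^ 2) * (0.47 * (2 * 0.47 * t ^ 2 - 0.0513))
    = 18.4 * 0.47 * (2 * 0.47 * t ^ 2 - 0.0513) / t ^ 2 by field_simp]
  rw [le_div_iff₀ (by positivity)]
  nlinarith

/-- the per-ring numerics, outer region: `8/(0.2(0.4t² − κ)) ≤ 100.1/t²` for `t ≥ 17`. [folklore] -/
theorem ring_num_outer (t : ℝ) (ht : 17 ≤ t) :
    8 * t * (1 / (0.2 * t * (2 * 0.2 * t ^ 2 - 0.0513))) ≤ 100.1 * (1 / t ^ 2) := by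
  have ht0 : 0 < t := by linarith
  have hden : 0 < 2 * 0.2 * t ^ 2 - 0.0513 := by nlinarith
  rw [show 8 * t * (1 / (0.2 * t * (2 * 0.2 * t ^ 2 - 0.0513))) = 8 / (0.2 * (2 * 0.2 * t ^ 2 - 0.0513)) by
    field_simp]
  rw [div_le_iff₀ (by positivity), show (100.1 : ℝ) * (1 / t ^ 2) * (0.2 * (2 * 0.2 * t ^ 2 - 0.0513))
    = 100.1 * 0.2 * (2 * 0.2 * t ^ 2 - 0.0513) / t ^ 2 by field_simp]
  rw [le_div_iff₀ (by positivity)]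
  nlinarith

/-- shifting a sum over `[a, b)` by one. [folklore] -/
theorem sum_Ico_shift_one (h : ℕ → ℝ) (a b : ℕ) :
    ∑ n ∈ Finset.Ico a b, h (n + 1) = ∑ j ∈ Finset.Icc (a + 1) b, h j := by
  rw [Finset.sum_Ico_add' h a b 1]
  have : Finset.Ico (a + 1) (b + 1) = Finset.Icc (a + 1) b := by
    ext j; simp only [Finset.mem_Ico, Finset.mem_Icc]; omega
  rw [this]

/-! ## §4 The box sum of the `LamIncrementBound` weights -/

/-- ★ `Σ_{m ∈ box∖0} |mᵢ| / (c_m |m|² (2c_m|m|² − κ)) ≤ 28` (`κ = 0.0513`; `c_m = 0.47` on `|m|∞ ≤ N₁`, `0.2` beyond;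
`16 ≤ N₁ ≤ N`; `i` selects the coordinate). [folklore] -/
theorem box_weight_sum_le (N₁ N : ℕ) (hN₁ : 16 ≤ N₁) (hN : N₁ ≤ N) (i : Bool) :
    ∑ m ∈ puncturedBox N,
        ((if i then m.1 else m.2).natAbs : ℝ)
          / ((if m.1.natAbs ≤ N₁ ∧ m.2.natAbs ≤ N₁ then (0.47 : ℝ) else 0.2)
              * (((m.1 ^ 2 + m.2 ^ 2 : ℤ)) : ℝ)
              * (2 * (if m.1.natAbs ≤ N₁ ∧ m.2.natAbs ≤ N₁ then (0.47 : ℝ) else 0.2)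
                  * (((m.1 ^ 2 + m.2 ^ 2 : ℤ)) : ℝ) - 0.0513)) ≤ 28 := by
  set g : ℤ × ℤ → ℝ := fun m => ((if i then m.1 else m.2).natAbs : ℝ)
          / ((if m.1.natAbs ≤ N₁ ∧ m.2.natAbs ≤ N₁ then (0.47 : ℝ) else 0.2)
              * (((m.1 ^ 2 + m.2 ^ 2 : ℤ)) : ℝ)
              * (2 * (if m.1.natAbs ≤ N₁ ∧ m.2.natAbs ≤ N₁ then (0.47 : ℝ) else 0.2)
                  * (((m.1 ^ 2 + m.2 ^ 2 : ℤ)) : ℝ) - 0.0513)) with hg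
  show ∑ m ∈ puncturedBox N, g m ≤ 28
  -- split off the innermost ring
  have hsplit : ∑ m ∈ puncturedBox N, g m
      = (∑ m ∈ puncturedBox 1, g m) + ∑ m ∈ puncturedBox N \ puncturedBox 1, g m := by
    rw [Finset.sum_sdiff_eq_sub (puncturedBox_subset (by omega : 1 ≤ N))]; ring
  -- (1) the innermost ring: at most 7.12
  have h1 : ∑ m ∈ puncturedBox 1, g m ≤ 7.12 := by
    have hin : ∀ a b : ℤ, a.natAbs ≤ 1 → b.natAbs ≤ 1 → (a.natAbs ≤ N₁ ∧ b.natAbs ≤ N₁) := fun a b ha hb => ⟨by omega, by omega⟩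
    rw [pbox_one_eq]
    rw [Finset.sum_insert (by decide), Finset.sum_insert (by decide), Finset.sum_insert (by decide),
      Finset.sum_insert (by decide), Finset.sum_insert (by decide), Finset.sum_insert (by decide),
      Finset.sum_insert (by decide), Finset.sum_singleton]
    simp only [hg, if_pos (hin (-1) (-1) (by norm_num) (by norm_num)), if_pos (hin (-1) 0 (by norm_num) (by norm_num)),
      if_pos (hin (-1) 1 (by norm_num) (by norm_num)), if_pos (hin 0 (-1) (by norm_num) (by norm_num)),
      if_pos (hin 0 1 (by norm_num) (by norm_num)), if_pos (hin 1 (-1) (by norm_num) (by norm_num)),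
      if_pos (hin 1 0 (by norm_num) (by norm_num)), if_pos (hin 1 1 (by norm_num) (by norm_num))]
    cases i <;> simp <;> norm_num
  -- (2) the rings `2 ≤ n+1`: ring-wise bound
  set φ : ℕ → ℝ := fun n => if n + 1 ≤ N₁ then 1 / (0.47 * ((n : ℝ) + 1) * (2 * 0.47 * ((n : ℝ) + 1) ^ 2 - 0.0513))
      else 1 / (0.2 * ((n : ℝ) + 1) * (2 * 0.2 * ((n : ℝ) + 1) ^ 2 - 0.0513)) with hφ
  have hring : ∀ n : ℕ, 1 ≤ n → n < N → ∀ m ∈ puncturedBox (n + 1) \ puncturedBox n, g m ≤ φ n := by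
    intro n hn _ m hm
    obtain ⟨hm1, hm2, hsq, hmax⟩ := ring_facts n m hm
    have ht : (2 : ℝ) ≤ (n : ℝ) + 1 := by
      have : (1 : ℝ) ≤ n := by exact_mod_cast hn
      linarith
    have hsel : ((if i then m.1 else m.2).natAbs : ℝ) ≤ (n : ℝ) + 1 := by
      cases i
      · simp only [Bool.false_eq_true, if_false]; exact hm2
      · simp only [if_true]; exact hm1
    -- region indicator on the ring: both coordinates `≤ N₁` iff `n + 1 ≤ N₁`
    have hreg : (m.1.natAbs ≤ N₁ ∧ m.2.natAbs ≤ N₁) ↔ n + 1 ≤ N₁ := by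
      constructor
      · rintro ⟨a1, a2⟩; rcases hmax with h | h <;> omega
      · intro h
        have h' : (((n + 1 : ℕ)) : ℝ) ≤ (N₁ : ℝ) := by exact_mod_cast h
        push_cast at h'
        have a1 : (m.1.natAbs : ℝ) ≤ N₁ := hm1.trans h'
        have a2 : (m.2.natAbs : ℝ) ≤ N₁ := hm2.trans h'
        exact ⟨by exact_mod_cast a1, by exact_mod_cast a2⟩
    by_cases hr : n + 1 ≤ N₁
    · have hc : (if m.1.natAbs ≤ N₁ ∧ m.2.natAbs ≤ N₁ then (0.47 : ℝ) else 0.2) = 0.47 := if_pos (hreg.mpr hr)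
      have hφn : φ n = 1 / (0.47 * ((n : ℝ) + 1) * (2 * 0.47 * ((n : ℝ) + 1) ^ 2 - 0.0513)) := by
        rw [hφ]; simp only [if_pos hr]
      rw [hg]; simp only [hc]; rw [hφn]
      exact weight_le 0.47 _ _ _ (by norm_num) (by linarith) hsel hsq (by nlinarith)
    · have hc : (if m.1.natAbs ≤ N₁ ∧ m.2.natAbs ≤ N₁ then (0.47 : ℝ) else 0.2) = 0.2 :=
        if_neg (fun h => hr (hreg.mp h))
      have hφn : φ n = 1 / (0.2 * ((n : ℝ) + 1) * (2 * 0.2 * ((n : ℝ) + 1) ^ 2 - 0.0513)) := by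
        rw [hφ]; simp only [if_neg hr]
      rw [hg]; simp only [hc]; rw [hφn]
      exact weight_le 0.2 _ _ _ (by norm_num) (by linarith) hsel hsq (by nlinarith)
  have h2 := sum_sdiff_pbox_le g φ 1 N (by omega) hring
  -- (3) the ring sums
  have h3 : ∑ n ∈ Finset.Ico 1 N, 8 * ((n : ℝ) + 1) * φ n ≤ 18.4 * (3 / 4) + 100.1 / 16 := by
    rw [← Finset.sum_Ico_consecutive _ (by omega : 1 ≤ N₁) hN]
    have hin : ∑ n ∈ Finset.Ico 1 N₁, 8 * ((n : ℝ) + 1) * φ n ≤ 18.4 * (3 / 4) := by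
      have hle : ∀ n ∈ Finset.Ico 1 N₁, 8 * ((n : ℝ) + 1) * φ n ≤ 18.4 * (1 / (((n + 1 : ℕ)) : ℝ) ^ 2) := by
        intro n hn
        rw [Finset.mem_Ico] at hn
        rw [hφ]; simp only [if_pos (show n + 1 ≤ N₁ by omega)]
        push_cast
        have h1n : (1 : ℝ) ≤ n := by exact_mod_cast hn.1
        exact ring_num_inner _ (by linarith)
      refine (Finset.sum_le_sum hle).trans ?_
      rw [← Finset.mul_sum, sum_Ico_shift_one (fun j => (1 : ℝ) / (j : ℝ) ^ 2) 1 N₁]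
      have hs2 : ∑ j ∈ Finset.Icc (1 + 1) N₁, (1 : ℝ) / (j : ℝ) ^ 2
          = 1 / 4 + ∑ j ∈ Finset.Icc (2 + 1) N₁, (1 : ℝ) / (j : ℝ) ^ 2 := by
        have : Finset.Icc (1 + 1) N₁ = insert 2 (Finset.Icc (2 + 1) N₁) := by
          ext j; simp only [Finset.mem_Icc, Finset.mem_insert]; omega
        rw [this, Finset.sum_insert (by simp)]
        norm_num
      rw [hs2]
      have := sum_inv_sq_Icc_le 2 N₁ (by norm_num)
      nlinarith
    have hout : ∑ n ∈ Finset.Ico N₁ N, 8 * ((n : ℝ) + 1) * φ n ≤ 100.1 / 16 := by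
      have hle : ∀ n ∈ Finset.Ico N₁ N, 8 * ((n : ℝ) + 1) * φ n ≤ 100.1 * (1 / (((n + 1 : ℕ)) : ℝ) ^ 2) := by
        intro n hn
        rw [Finset.mem_Ico] at hn
        rw [hφ]; simp only [if_neg (show ¬ (n + 1 ≤ N₁) by omega)]
        push_cast
        have hNn : ((N₁ : ℝ)) ≤ n := by exact_mod_cast hn.1
        have h16' : (16 : ℝ) ≤ N₁ := by exact_mod_cast hN₁
        exact ring_num_outer _ (by linarith)
      refine (Finset.sum_le_sum hle).trans ?_
      rw [← Finset.mul_sum, sum_Ico_shift_one (fun j => (1 : ℝ) / (j : ℝ) ^ 2) N₁ N]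
      have h16 := sum_inv_sq_Icc_le N₁ N (by omega)
      have hN16 : (1 : ℝ) / N₁ ≤ 1 / 16 := by
        apply one_div_le_one_div_of_le (by norm_num); exact_mod_cast hN₁
      nlinarith
    linarith
  rw [hsplit]
  have : (7.12 : ℝ) + (18.4 * (3 / 4) + 100.1 / 16) ≤ 28 := by norm_num
  linarith

end RowC

end Summit.HubbardSuperconductivity.HubbardSuperconductivity.Theorems.AnisotropyChord.Transfer.Fibre3

end
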